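import Literature.AlgebraicGeometry.Motives.OrthogonalRotationGeneration
import Literature.AlgebraicGeometry.Motives.ZarhinHodgeGroupDerivationLie
import Mathlib.Algebra.DirectSum.Module
import Mathlib.LinearAlgebra.Eigenspace.Basic
import HarnessLib

/-!
# A hyperbolic rotation fixes every tensor killed by its generator

Continuation of `OrthogonalRotationGeneration.lean` (hyperbolic pairs `e, f`, the rotations
`rotation B e f z : e ↦ z e, f ↦ z⁻¹ f, {e,f}^⊥ ↦ id` and their generator
`rotationGenerator B e f : e ↦ e, f ↦ -f, {e,f}^⊥ ↦ 0`). For the derivation action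
`ρ = tensorDerivation a b` on the tensor spaces `T^{a,b}_K V = V^{⊗a} ⊗ (V^∨)^{⊗b}`
(`MumfordTateInvariantsDerivation.lean`) and the action `tensorSpaceActOver` of `GL(V)`, over a
field of characteristic `0`:

* `tensorSpaceActOver_rotationEquiv_eq_self`: if `ρ(rotationGenerator B e f) s = 0` then
  `rotation B e f z · s = s` for every `z ≠ 0`.

Proof: `V = V₁ ⊕ V₋₁ ⊕ V₀`, the eigenspaces of the generator, on which the rotation acts by
`z, z⁻¹, 1 = z¹, z⁻¹, z⁰` (`rotation_apply_of_generator_eq_self/_neg/_zero`, a computation with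
the two orthogonal rank-one idempotents `x ↦ B(f,x) e`, `x ↦ B(e,x) f`); in a basis adapted to the
decomposition both operators are diagonal, and the "exponential gadget"
`tensorSpaceActOver_eq_self_of_tensorDerivation_eq_zero` of `ZarhinHodgeGroupDerivationLie.lean`
applies, additive relations among the integer eigenvalues `1, -1, 0` giving multiplicative ones
among `z^{±1}, 1` (Borel, *Linear Algebraic Groups*, §7.3 and §8.2: a torus fixes the tensors its
Lie algebra annihilates). Also: the rotations in a fixed pair form a one-parameter group
(`rotation_mul_rotation`, `rotationEquiv`).

This is the last generic input for the integration step of the tree's elementary proof of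
Zarhin's theorem on the Hodge group of a Hodge structure of K3 type (Huybrechts, *Lectures on K3
Surfaces*, Thm. 3.3.9): combined with `exists_eq_prod_rotations`, an element of `SO(V_σ, ψ)(ℂ)`
(resp. a contragredient pair on `V_σ ⊕ V_σ̄`) fixes every complexified Hodge tensor as soon as the
`ψ`-antisymmetric generators supported on the eigenspaces of the endomorphism field kill it. No
named facts; the only definition is the linear automorphism `rotationEquiv`.

## References

* A. Borel, *Linear Algebraic Groups*, 2nd ed., GTM 126 (1991), §7.3, §8.2.
* E. Artin, *Geometric Algebra*, Interscience (1957), Ch. III §4.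
* D. Huybrechts, *Lectures on K3 Surfaces*, CUP (2016), Thm. 3.3.9.
-/

noncomputable section

namespace Literature.AlgebraicGeometry.Motives

namespace OrthogonalGeneration

universe u v

variable {K : Type u} [Field K] {V : Type v} [AddCommGroup V] [Module K V]

/-! ### Bridge: a hyperbolic rotation fixes every tensor killed by its generator -/

section Bridge

open scoped TensorProduct

variable {B : LinearMap.BilinForm K V} {e f : V}

/-- `rotation B e f 1 = 1`. [folklore] -/
theorem rotation_one (B : LinearMap.BilinForm K V) (e f : V) : rotation B e f 1 = 1 := by
  ext x
  rw [rotation_apply, sub_self, inv_one, sub_self, zero_mul, zero_mul, zero_smul, zero_smul,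
    add_zero, add_zero, Module.End.one_apply]

/-- **Rotations in a fixed hyperbolic pair form a one-parameter group**:
`rotation z * rotation w = rotation (z w)`. [folklore] -/
theorem rotation_mul_rotation (hB : B.IsSymm) (he : B e e = 0) (hf : B f f = 0) (hef : B e f = 1)
    (z w : K) : rotation B e f z * rotation B e f w = rotation B e f (z * w) := by
  ext x
  obtain ⟨hex₀, hfx₀⟩ := form_left_sub_sub_eq_zero hB he hf hef x
  have hx : x = B f x • e + B e x • f + (x - B f x • e - B e x • f) := by abel
  rw [hx]
  simp only [map_add, map_smul, Module.End.mul_apply, rotation_apply_left hB he hef,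
    rotation_apply_right hf hef, rotation_apply_of_ortho _ hex₀ hfx₀, smul_smul, mul_inv_rev,
    mul_comm w z, mul_comm w⁻¹ z⁻¹]

/-- The hyperbolic rotation as a linear automorphism (inverse: the rotation by `z⁻¹`).
[folklore] -/
def rotationEquiv (hB : B.IsSymm) (he : B e e = 0) (hf : B f f = 0) (hef : B e f = 1) {z : K}
    (hz : z ≠ 0) : V ≃ₗ[K] V :=
  LinearEquiv.ofLinear (rotation B e f z) (rotation B e f z⁻¹)
    (by rw [← Module.End.mul_eq_comp, rotation_mul_rotation hB he hf hef, mul_inv_cancel₀ hz,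
      rotation_one]; rfl)
    (by rw [← Module.End.mul_eq_comp, rotation_mul_rotation hB he hf hef, inv_mul_cancel₀ hz,
      rotation_one]; rfl)

/-- The underlying linear map of `rotationEquiv` is `rotation`. [folklore] -/
@[simp]
theorem coe_rotationEquiv (hB : B.IsSymm) (he : B e e = 0) (hf : B f f = 0) (hef : B e f = 1)
    {z : K} (hz : z ≠ 0) : (rotationEquiv hB he hf hef hz : V →ₗ[K] V) = rotation B e f z :=
  rfl

/-- **On the `1`-eigenvectors of the generator the rotation is `z`** (`2 ≠ 0`). [folklore] -/
theorem rotation_apply_of_generator_eq_self [NeZero (2 : K)] (he : B e e = 0) (hef : B e f = 1)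
    (z : K) {v : V} (hv : rotationGenerator B e f v = v) : rotation B e f z v = z • v := by
  rw [rotationGenerator_apply] at hv
  have h1 : B e v = 0 := by
    have h := congrArg (B e) hv
    simp only [map_sub, map_smul, smul_eq_mul, he, hef, mul_zero, mul_one, zero_sub] at h
    have h' : (2 : K) * B e v = 0 := by linear_combination -h
    exact (mul_eq_zero.1 h').resolve_left (NeZero.ne 2)
  rw [h1, zero_smul, sub_zero] at hv
  rw [rotation_apply, h1, mul_zero, zero_smul, add_zero, mul_smul, hv, sub_smul, one_smul,
    add_sub_cancel]

/-- **On the `-1`-eigenvectors of the generator the rotation is `z⁻¹`** (`2 ≠ 0`). [folklore] -/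
theorem rotation_apply_of_generator_eq_neg [NeZero (2 : K)] (hB : B.IsSymm) (hf : B f f = 0)
    (hef : B e f = 1) (z : K) {v : V} (hv : rotationGenerator B e f v = -v) :
    rotation B e f z v = z⁻¹ • v := by
  rw [rotationGenerator_apply] at hv
  have h1 : B f v = 0 := by
    have h := congrArg (B f) hv
    simp only [map_sub, map_smul, map_neg, smul_eq_mul, hf, hB.eq f e, hef, mul_zero, mul_one,
      sub_zero] at h
    have h' : (2 : K) * B f v = 0 := by linear_combination h
    exact (mul_eq_zero.1 h').resolve_left (NeZero.ne 2)
  rw [h1, zero_smul, zero_sub, neg_inj] at hv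
  rw [rotation_apply, h1, mul_zero, zero_smul, add_zero, mul_smul, hv, sub_smul, one_smul,
    add_sub_cancel]

/-- **On the kernel of the generator the rotation is the identity.** [folklore] -/
theorem rotation_apply_of_generator_eq_zero (hB : B.IsSymm) (he : B e e = 0) (hf : B f f = 0)
    (hef : B e f = 1) (z : K) {v : V} (hv : rotationGenerator B e f v = 0) :
    rotation B e f z v = v := by
  rw [rotationGenerator_apply, sub_eq_zero] at hv
  have h1 : B f v = 0 := by
    have h := congrArg (B f) hv
    simp only [map_smul, smul_eq_mul, hf, hB.eq f e, hef, mul_zero, mul_one] at h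
    exact h
  have h2 : B e v = 0 := by
    have h := congrArg (B e) hv
    simp only [map_smul, smul_eq_mul, he, hef, mul_zero, mul_one] at h
    exact h.symm
  exact rotation_apply_of_ortho z h2 h1

/-- Products of integer powers with a non-zero base (restated to keep imports light). [folklore] -/
theorem prod_zpow_eq_zpow_sum' {ι : Type*} (s : Finset ι) (g : ι → ℤ) {a : K} (ha : a ≠ 0) :
    ∏ i ∈ s, a ^ g i = a ^ ∑ i ∈ s, g i := by
  classical
  induction s using Finset.induction_on with
  | empty => simp
  | insert i s hi ih => rw [Finset.prod_insert hi, Finset.sum_insert hi, ih, zpow_add₀ ha]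

/-- **A hyperbolic rotation fixes every tensor killed by its infinitesimal generator**
(characteristic `0`): if `ρ(X_{e,f}) s = 0` for the derivation action of the generator
`X_{e,f} = rotationGenerator B e f` on `s ∈ T^{a,b}_K V`, then `rotation B e f z · s = s` for every
`z ≠ 0`. Proof: `V = V₁ ⊕ V₋₁ ⊕ V₀` (eigenspaces of `X_{e,f}`), on which the rotation acts by
`z, z⁻¹, 1 = z^{1}, z^{-1}, z^{0}`; in an adapted basis both are diagonal and the exponential
gadget `tensorSpaceActOver_eq_self_of_tensorDerivation_eq_zero` applies, the additive relations
among the integer eigenvalues `1, -1, 0` giving the multiplicative ones among `z^{±1}, 1`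
(Borel, *Linear Algebraic Groups*, §7.3, §8.2: a torus fixes what its Lie algebra annihilates).
[folklore] -/
theorem tensorSpaceActOver_rotationEquiv_eq_self [CharZero K] [FiniteDimensional K V]
    (hB : B.IsSymm) (he : B e e = 0) (hf : B f f = 0) (hef : B e f = 1) {z : K} (hz : z ≠ 0)
    {a b : ℕ} {s : hodgeTensorSpaceOver K V a b}
    (hs : tensorDerivation a b (rotationGenerator B e f) s = 0) :
    tensorSpaceActOver (rotationEquiv hB he hf hef hz) s = s := by
  classical
  haveI : NeZero (2 : K) := ⟨two_ne_zero⟩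
  set X := rotationGenerator B e f with hX
  -- the three eigenvalues `1, -1, 0` and the integer exponents
  set w : Fin 3 → K := ![1, -1, 0] with hw
  set nn : Fin 3 → ℤ := ![1, -1, 0] with hnn
  have hwn : ∀ i, w i = (nn i : K) := by
    intro i
    fin_cases i <;> simp [hw, hnn]
  have hwinj : Function.Injective w := by
    intro i j hij
    fin_cases i <;> fin_cases j <;> simp [hw] at hij ⊢
    all_goals
      first
      | exact absurd (by linear_combination hij : (2 : K) = 0) two_ne_zero
      | exact absurd (by linear_combination (-1 : K) * hij : (2 : K) = 0) two_ne_zero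
  -- the eigenspace decomposition of `X`
  set A : Fin 3 → Submodule K V := fun i => Module.End.eigenspace X (w i) with hA
  have hind : iSupIndep A := (Module.End.eigenspaces_iSupIndep X).comp hwinj
  have htop : ⨆ i, A i = ⊤ := by
    rw [eq_top_iff]
    intro x _
    obtain ⟨hex₀, hfx₀⟩ := form_left_sub_sub_eq_zero hB he hf hef x
    have hx : x = B f x • e + B e x • f + (x - B f x • e - B e x • f) := by abel
    rw [hx]
    refine Submodule.add_mem _ (Submodule.add_mem _ ?_ ?_) ?_
    · refine Submodule.mem_iSup_of_mem (0 : Fin 3) (Submodule.smul_mem _ _ ?_)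
      rw [hA, Module.End.mem_eigenspace_iff, hX, rotationGenerator_apply_left hB he hef]
      simp [hw]
    · refine Submodule.mem_iSup_of_mem (1 : Fin 3) (Submodule.smul_mem _ _ ?_)
      rw [hA, Module.End.mem_eigenspace_iff, hX, rotationGenerator_apply_right hf hef]
      simp [hw]
    · refine Submodule.mem_iSup_of_mem (2 : Fin 3) ?_
      rw [hA, Module.End.mem_eigenspace_iff, hX, rotationGenerator_apply_of_ortho hex₀ hfx₀]
      simp [hw]
  have hint : DirectSum.IsInternal A :=
    DirectSum.isInternal_submodule_of_iSupIndep_of_iSup_eq_top hind htop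
  set E := hint.collectedBasis fun i => Module.finBasis K (A i) with hE
  have hEmem : ∀ k, E k ∈ A k.1 := fun k => hint.collectedBasis_mem _ k
  have hXE : ∀ k, X (E k) = (nn k.1 : K) • E k := fun k => by
    rw [← hwn]
    exact Module.End.mem_eigenspace_iff.1 (hEmem k)
  have hrot : ∀ (i : Fin 3) (v : V), X v = (nn i : K) • v → rotation B e f z v = (z ^ nn i) • v := by
    intro i v hv
    fin_cases i
    · simp [hnn] at hv ⊢
      exact rotation_apply_of_generator_eq_self he hef z hv
    · simp [hnn] at hv ⊢
      exact rotation_apply_of_generator_eq_neg hB hf hef z hv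
    · simp [hnn] at hv ⊢
      exact rotation_apply_of_generator_eq_zero hB he hf hef z hv
  have hRE : ∀ k, rotationEquiv hB he hf hef hz (E k) = (z ^ nn k.1) • E k := fun k => by
    change rotation B e f z (E k) = _
    exact hrot k.1 (E k) (hXE k)
  refine tensorSpaceActOver_eq_self_of_tensorDerivation_eq_zero E hRE hXE (fun x hx => ?_) hs
  -- additive relation among integer exponents ⇒ multiplicative relation among powers of `z`
  have hint' : ((∑ i, nn (x.1 i).1) - ∑ j, nn (x.2 j).1 : ℤ) = 0 := by
    have h : (((∑ i, nn (x.1 i).1 - ∑ j, nn (x.2 j).1 : ℤ)) : K) = 0 := by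
      push_cast
      exact hx
    exact_mod_cast h
  rw [prod_zpow_eq_zpow_sum', prod_zpow_eq_zpow_sum', ← zpow_neg, ← zpow_add₀ hz,
    ← sub_eq_add_neg, hint', zpow_zero]
  · exact hz
  · exact hz

end Bridge

end OrthogonalGeneration

end Literature.AlgebraicGeometry.Motives

end
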